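import Literature.NumberTheory.Sieve.HeathBrownCubicTypeIIWeights
import Literature.NumberTheory.Sieve.LargeSieveMultidim
import Literature.NumberTheory.Sieve.HeathBrownCubicTypeII
import HarnessLib

/-!
# Heath-Brown's Lemma 3.10, §13 Lemma 13.1: the large sieve applied to `∑*_{b (mod q)} |S(b/q; C)|²`

Support for the proof of **Lemma 3.10** of D. R. Heath-Brown, *Primes represented by `x³ + 2y³`*,
Acta Math. 186 (2001), §13 Lemma 13.1:

> "LEMMA 13.1. Let `S(a)` be given by (13.1), with `C` a cube of side `S₀`. Then
> `∑_{Q < q ≤ 2Q} ∑*_{b (mod q)} |S(q⁻¹b)|² ≪ (S₀³ + Q²S₀² + Q⁴) ∑_{β̂ ∈ C} |G_β|²`."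

This file bridges the PROVED three-dimensional large sieve `LargeSieve.largeSieve_dim_three` (stated for
`Fin 3 → ℤ`, `latticeBox`, `fareyVecs`) to the sums `Ustar w C q = ∑*_{b (mod q)} |S(b/q; C)|²` of
`HeathBrownCubicTypeIIWeights` over subsets `C` of a lattice cube in `ℤ × ℤ × ℤ`:

* `toFin3`, `ofFin3` — the coordinate equivalence; `latticeCube a S₀ ↪ latticeBox lo (⌊S₀⌋₊ + 1)`;
* **`sum_Ustar_dyadic_le`**: for `C ⊆ latticeCube a S₀` (`S₀ ≥ 0`) and `Q : ℕ`,
  `∑_{Q < q ≤ 2Q} U*(q) ≤ 51840 (N³ + Q²N² + Q⁴) ∑_{v ∈ C} w(v)²`, `N = ⌊S₀⌋₊ + 1`.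

## References

* D. R. Heath-Brown, *Primes represented by `x³ + 2y³`*, Acta Math. 186 (2001), §13 Lemma 13.1.
  [cite: HeathBrownActa2001, Lemma 13.1]

## Mathlib / tree search

Tree: `LargeSieveMultidim` (`largeSieve_dim_three`, `fareyVecs`, `latticeBox`, `IsPrimVec`, `mem_fareyVecs`),
`HeathBrownCubicTypeIIWeights` (`primRes`, `Ustar`, `CoprimeRes`), `HeathBrownCubicTypeIICharSum` (`Sfrac`),
`HeathBrownCubicTypeII` (`latticeCube`).
-/

noncomputable section

open Finset

namespace Literature.NumberTheory.Sieve.CubicSieve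

open LargeSieve

/-! ### The coordinate equivalence -/

/-- `ℤ × ℤ × ℤ → (Fin 3 → ℤ)`. [folklore] -/
def toFin3 (v : ℤ × ℤ × ℤ) : Fin 3 → ℤ := ![v.1, v.2.1, v.2.2]

/-- `(Fin 3 → ℤ) → ℤ × ℤ × ℤ`. [folklore] -/
def ofFin3 (f : Fin 3 → ℤ) : ℤ × ℤ × ℤ := (f 0, f 1, f 2)

/-- `ofFin3 ∘ toFin3 = id`. [folklore] -/
@[simp] theorem ofFin3_toFin3 (v : ℤ × ℤ × ℤ) : ofFin3 (toFin3 v) = v := by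
  simp [ofFin3, toFin3]

/-- `toFin3 ∘ ofFin3 = id`. [folklore] -/
@[simp] theorem toFin3_ofFin3 (f : Fin 3 → ℤ) : toFin3 (ofFin3 f) = f := by
  ext l; fin_cases l <;> simp [ofFin3, toFin3]

/-- `toFin3` is injective. [folklore] -/
theorem toFin3_injective : Function.Injective toFin3 := fun v w h => by
  have := congrArg ofFin3 h; simpa using this

/-- The coordinates of `toFin3 v`. [folklore] -/
@[simp] theorem toFin3_apply (v : ℤ × ℤ × ℤ) : toFin3 v 0 = v.1 ∧ toFin3 v 1 = v.2.1 ∧ toFin3 v 2 = v.2.2 := by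
  simp [toFin3]

/-- `∑_l (toFin3 v)_l (toFin3 b)_l / q = (b · v)/q`. [folklore] -/
theorem sum_toFin3_mul (v b : ℤ × ℤ × ℤ) (q : ℕ) :
    ∑ l : Fin 3, ((toFin3 v l : ℤ) : ℝ) * (((toFin3 b l : ℤ) : ℝ) / (q : ℝ)) = ((dot3 b v : ℤ) : ℝ) / q := by
  simp only [Fin.sum_univ_three, toFin3, Matrix.cons_val_zero, Matrix.cons_val_one, Matrix.cons_val_two,
    Matrix.tail_cons, Matrix.head_cons, dot3]
  push_cast; ring

/-! ### The lattice cube inside a lattice box -/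

/-- `⌊a + S₀⌋ ≤ ⌊a⌋ + (⌊S₀⌋₊ + 1)` (`S₀ ≥ 0`). [folklore] -/
theorem floor_add_le_floor_add (a S₀ : ℝ) : ⌊a + S₀⌋ ≤ ⌊a⌋ + ((⌊S₀⌋₊ + 1 : ℕ) : ℤ) := by
  have h1 : (⌊a + S₀⌋ : ℝ) ≤ a + S₀ := Int.floor_le _
  have h2 : a < ⌊a⌋ + 1 := Int.lt_floor_add_one a
  have h3 : S₀ < ⌊S₀⌋₊ + 1 := Nat.lt_floor_add_one S₀
  have h4 : (⌊a + S₀⌋ : ℝ) < ⌊a⌋ + ((⌊S₀⌋₊ + 1 : ℕ) : ℝ) + 1 := by push_cast; linarith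
  have h5 : ⌊a + S₀⌋ < ⌊a⌋ + ((⌊S₀⌋₊ + 1 : ℕ) : ℤ) + 1 := by exact_mod_cast h4
  omega

/-- The lower corner of the box. [folklore] -/
def loOf (a : ℝ × ℝ × ℝ) : Fin 3 → ℤ := ![⌊a.1⌋, ⌊a.2.1⌋, ⌊a.2.2⌋]

/-- `toFin3` maps `latticeCube a S₀` into `latticeBox (loOf a) (⌊S₀⌋₊ + 1)`. [folklore] -/
theorem toFin3_mem_latticeBox {a : ℝ × ℝ × ℝ} {S₀ : ℝ} {v : ℤ × ℤ × ℤ}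
    (hv : v ∈ latticeCube a S₀) : toFin3 v ∈ LargeSieve.latticeBox 3 (loOf a) (⌊S₀⌋₊ + 1) := by
  rw [latticeCube, mem_product, mem_product, mem_Ioc, mem_Ioc, mem_Ioc] at hv
  obtain ⟨⟨h1, h1'⟩, ⟨h2, h2'⟩, ⟨h3, h3'⟩⟩ := hv
  rw [LargeSieve.latticeBox, Fintype.mem_piFinset]
  intro l
  rw [mem_Ioc]
  fin_cases l
  · simp only [toFin3, loOf, Fin.zero_eta, Matrix.cons_val_zero]
    exact ⟨h1, h1'.trans (floor_add_le_floor_add _ _)⟩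
  · simp only [toFin3, loOf, Fin.mk_one, Matrix.cons_val_one]
    exact ⟨h2, h2'.trans (floor_add_le_floor_add _ _)⟩
  · simp only [toFin3, loOf, Fin.reduceFinMk, Matrix.cons_val_two, Matrix.tail_cons, Matrix.head_cons]
    exact ⟨h3, h3'.trans (floor_add_le_floor_add _ _)⟩

/-! ### The dyadic large sieve for `U*` -/

open scoped Classical in
/-- **Lemma 13.1 for `U*`**: for `C ⊆ latticeCube a S₀`, real weights `w` and `Q : ℕ`,
`∑_{Q < q ≤ 2Q} ∑*_{b (mod q)} |S(b/q; C)|² ≤ 51840 (N³ + Q²N² + Q⁴) ∑_{v ∈ C} w(v)²`, `N = ⌊S₀⌋₊ + 1`.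
[cite: HeathBrownActa2001, Lemma 13.1] -/
theorem sum_Ustar_dyadic_le {a : ℝ × ℝ × ℝ} {S₀ : ℝ} {C : Finset (ℤ × ℤ × ℤ)}
    (hC : C ⊆ latticeCube a S₀) (w : ℤ × ℤ × ℤ → ℝ) (Q : ℕ) :
    ∑ q ∈ Ioc Q (2 * Q), Ustar w C q ≤
      51840 * (((⌊S₀⌋₊ + 1 : ℕ) : ℝ) ^ 3 + (Q : ℝ) ^ 2 * ((⌊S₀⌋₊ + 1 : ℕ) : ℝ) ^ 2 + (Q : ℝ) ^ 4) *
        ∑ v ∈ C, w v ^ 2 := by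
  classical
  set N : ℕ := ⌊S₀⌋₊ + 1 with hN
  have hNpos : 0 < N := Nat.succ_pos _
  -- the function on `Fin 3 → ℤ`
  set G : (Fin 3 → ℤ) → ℂ := fun f => if ofFin3 f ∈ C then (w (ofFin3 f) : ℂ) else 0 with hG
  have hLS := largeSieve_dim_three (loOf a) hNpos G Q
  -- identify the inner sums with `Sfrac`
  have hbox : C.image toFin3 ⊆ LargeSieve.latticeBox 3 (loOf a) N := by
    intro f hf
    obtain ⟨v, hv, rfl⟩ := mem_image.mp hf
    exact toFin3_mem_latticeBox (hC hv)
  have hinner : ∀ (q : ℕ) (b : ℤ × ℤ × ℤ),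
      ∑ β ∈ LargeSieve.latticeBox 3 (loOf a) N, G β * LargeSieve.e (∑ l, (β l : ℝ) * ((toFin3 b l : ℝ) / q)) =
        Sfrac w C q b := by
    intro q b
    -- restrict to the image of `C`
    rw [← sum_subset hbox (fun f _ hf => by
      have : ofFin3 f ∉ C := fun h => hf (mem_image.mpr ⟨ofFin3 f, h, toFin3_ofFin3 f⟩)
      simp [hG, this])]
    rw [sum_image (fun v _ v' _ h => toFin3_injective h), Sfrac]
    refine sum_congr rfl fun v hv => ?_
    simp only [hG, ofFin3_toFin3, if_pos hv]
    congr 1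
    congr 1
    have := sum_toFin3_mul v b q
    convert this using 2
  have hnormG : ∑ β ∈ LargeSieve.latticeBox 3 (loOf a) N, ‖G β‖ ^ 2 = ∑ v ∈ C, w v ^ 2 := by
    rw [← sum_subset hbox (fun f _ hf => by
      have : ofFin3 f ∉ C := fun h => hf (mem_image.mpr ⟨ofFin3 f, h, toFin3_ofFin3 f⟩)
      simp [hG, this])]
    rw [sum_image (fun v _ v' _ h => toFin3_injective h)]
    refine sum_congr rfl fun v hv => ?_
    simp only [hG, ofFin3_toFin3, if_pos hv, Complex.norm_real, Real.norm_eq_abs, sq_abs]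
  -- identify the point sets: `(q, b) ↦ ⟨q, toFin3 b⟩`
  have hpoints : ∑ q ∈ Ioc Q (2 * Q), Ustar w C q =
      ∑ x ∈ fareyVecs 3 Q, ‖Sfrac w C x.1 (ofFin3 x.2)‖ ^ 2 := by
    rw [show (∑ q ∈ Ioc Q (2 * Q), Ustar w C q) =
        ∑ x ∈ (Ioc Q (2 * Q)).sigma (fun q => primRes q), ‖Sfrac w C x.1 x.2‖ ^ 2 by
      rw [sum_sigma]; rfl]
    -- map `⟨q, b⟩ ↦ ⟨q, toFin3 b⟩`
    refine sum_nbij' (fun x => ⟨x.1, toFin3 x.2⟩) (fun x => ⟨x.1, ofFin3 x.2⟩) (fun x hx => ?_)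
      (fun x hx => ?_) (fun x _ => by simp) (fun x _ => by simp) (fun x _ => by simp)
    · rw [mem_sigma, primRes, mem_filter, mem_resVecs] at hx
      obtain ⟨hq, ⟨h1, h2, h3⟩, hcop⟩ := hx
      rw [mem_fareyVecs]
      refine ⟨by simpa [mem_Ioc] using hq, fun l => ?_, fun d hd hdl => hcop d hd ?_ ?_ ?_⟩
      · fin_cases l <;> simp [toFin3] <;> assumption
      · simpa [toFin3] using hdl 0
      · simpa [toFin3] using hdl 1
      · simpa [toFin3] using hdl 2
    · rw [mem_fareyVecs] at hx
      obtain ⟨hq, hb, hprim⟩ := hx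
      rw [mem_sigma, primRes, mem_filter, mem_resVecs]
      refine ⟨by simpa [mem_Ioc] using hq, ⟨hb 0, hb 1, hb 2⟩, fun d hd h1 h2 h3 => hprim d hd fun l => ?_⟩
      fin_cases l
      · simpa [ofFin3] using h1
      · simpa [ofFin3] using h2
      · simpa [ofFin3] using h3
  rw [hpoints]
  have hLS' : ∑ x ∈ fareyVecs 3 Q, ‖Sfrac w C x.1 (ofFin3 x.2)‖ ^ 2 ≤
      51840 * ((N : ℝ) ^ 3 + (Q : ℝ) ^ 2 * (N : ℝ) ^ 2 + (Q : ℝ) ^ 4) *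
        ∑ β ∈ LargeSieve.latticeBox 3 (loOf a) N, ‖G β‖ ^ 2 := by
    refine le_of_eq_of_le (sum_congr rfl fun x _ => ?_) hLS
    rw [← hinner x.1 (ofFin3 x.2), toFin3_ofFin3]
  rw [hnormG] at hLS'
  exact hLS'

end Literature.NumberTheory.Sieve.CubicSieve

end
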